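import Literature.MathematicalPhysics.QuantumFieldTheory.Balaban1983to89.Node00.EuclCovTransportOfRecord
import Literature.MathematicalPhysics.QuantumFieldTheory.Balaban1983to89.Node00.TransportOfRecordGaugeAE

/-!
# NODE 00 — `Node00.EuclCovTransportOfRecordOn`: [Balaban1987RG1] (2.17) p. 269 ∕ p. 263 for the transform of record ON A STABLE SET OF COARSE FIELDS over which the
# density is a.e.-invariant only (the currency the record's (2.9) cut-off affords: FILE E2 gives its invariance on the [B11] domain, not globally) — the Euclidean twin
# of dag-n09-w3's `Node00/TransportOfRecordGaugeAE` §2–§3 (`transportOfRecord_gaugeAct_ae_eq_on`, `TcanOfRecord_gaugeAct_of_mem_regSet_inter_of_on`): porter PT-A-2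
# FILE E4a (row S5-0 (ii))

CITATION HEADER.  [I] = [Balaban1987RG1] (2.17) p. 269, (0.13) p. 254, p. 263; [B7] = [Balaban1985Averaging] (10)–(13) p. 19.  Reused BY NAME: FILE E3
`isRT_comp_equivariant`-shape push-forward, dag-n09-w3's cut-density locality `transportOfRecord_mul_indicator_ae_eq` and localised determinacy
`canonVersion_comp_eqOn_inter_of_on`, K0e's `regSetOfRecord ∕ TcanOfRecord ∕ isOpenPosMeasure_piHaar_SUN`.

WHAT IS PROVED.  §1 `isRT_comp_equivariant_of_eventuallyEq` ([B7] (10) transported by an equivariant pair of measure-preserving bijections when the source density is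
only A.E.-invariant under the fine map).  §2 `ae_comp_cutDensity_of_on` (the cut density `ρ·𝟙_E∘Ū` is a.e.-invariant outright when `ρ` is a.e.-invariant over `Ū⁻¹E`
and `E` is stable).  §3 `transportOfRecord_comp_ae_eq_on` (generic equivariant pair) and its three instances `transportOfRecord_{translate,permute,creflect}_ae_eq_on`;
§4 `TcanOfRecord_comp_of_mem_regSet_inter_of_on` (generic) and `TcanOfRecord_{translate,permute,creflect}_of_mem_regSet_inter_of_on`: for an OPEN stable `O` over which `ρ`
is a.e.-invariant, `TcanOfRecord K k ρ (r V) = TcanOfRecord K k ρ V` at every `V ∈ regSetOfRecord K k ρ ∩ O`.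
HONEST FRAMING.  Measure-theoretic bookkeeping; nothing of Bałaban's estimates asserted, ported or discharged; no `sorry`, standard axioms; YM mass gap (Clay) NOT proved.
-/

noncomputable section

open MeasureTheory Set Filter

namespace Literature.MathematicalPhysics.QuantumFieldTheory.Balaban1983to89.Node00

open T4Continuum B12RTGaugeInvariance254
open T4AveragingDisintegration (integrable_kernelTransport)

/-! ## §1. The push-forward identity transported, a.e.-invariant source -/

section PushForward

variable {P : Params} {j : ℕ} {G : Type*} [GaugeGroup G] [MeasurableSpace G] [HaarData G]

/-- **[B7] (10) TRANSPORTED, A.E. SOURCE**: as FILE E3's `isRT_comp_equivariant`, but with `ρ ∘ Φf = ρ` only ALMOST EVERYWHERE — then `ρ′ ∘ Φc` is again a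
renormalisation image of `ρ` itself. [cite: Balaban1985Averaging, (10)–(13) p.19; Balaban1987RG1, (2.17) p.269] -/
theorem isRT_comp_equivariant_of_eventuallyEq {avg : GaugeField P j G → GaugeField P (j + 1) G} {ρ : Density P j G} {ρ' : Density P (j + 1) G}
    (h : IsRT avg ρ ρ') (Φf Ψf : GaugeField P j G → GaugeField P j G) (Φc Ψc : GaugeField P (j + 1) G → GaugeField P (j + 1) G)
    (hIf : ∀ g : GaugeField P j G → ℝ, ∫ U, g (Φf U) ∂(fieldMeasure P j G) = ∫ U, g U ∂(fieldMeasure P j G))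
    (hIc : ∀ g : GaugeField P (j + 1) G → ℝ, ∫ V, g (Φc V) ∂(fieldMeasure P (j + 1) G) = ∫ V, g V ∂(fieldMeasure P (j + 1) G))
    (hΨc : Measurable Ψc) (hΨΦc : ∀ V, Ψc (Φc V) = V) (hΨΦf : ∀ U, Ψf (Φf U) = U) (hΦΨf : ∀ U, Φf (Ψf U) = U)
    (hinter : ∀ U, avg (Φf U) = Φc (avg U)) (hρ : (fun U => ρ (Φf U)) =ᵐ[fieldMeasure P j G] ρ) :
    IsRT avg ρ (fun V => ρ' (Φc V)) := by
  intro f hf hbd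
  rw [isRT_comp_equivariant h Φf Ψf Φc Ψc hIf hIc hΨc hΨΦc hΨΦf hΦΨf hinter f hf hbd]
  refine integral_congr_ae ?_
  filter_upwards [hρ] with U hU
  rw [hU]

end PushForward

/-! ## §2. The cut density is a.e.-invariant outright -/

section Cut

variable {P : Params} {j : ℕ} {G : Type*} [GaugeGroup G] [MeasurableSpace G] [HaarData G]

/-- If `ρ ∘ Φf = ρ` a.e. over `Ū⁻¹ E`, `E` is `Φc`-stable and `Ū ∘ Φf = Φc ∘ Ū`, then the cut density `U ↦ ρ(U)·𝟙_E(ŪU)` is a.e.-invariant under `Φf` outright.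
[cite: Balaban1987RG1, (2.17) p.269 and (2.1) p.265 (bookkeeping)] -/
theorem ae_comp_cutDensity_of_on {avg : GaugeField P j G → GaugeField P (j + 1) G} {ρ : Density P j G} (Φf : GaugeField P j G → GaugeField P j G)
    (Φc : GaugeField P (j + 1) G → GaugeField P (j + 1) G) {E : Set (GaugeField P (j + 1) G)} (hEst : ∀ V, Φc V ∈ E ↔ V ∈ E)
    (hinter : ∀ U, avg (Φf U) = Φc (avg U)) (hinv : ∀ᵐ U ∂(fieldMeasure P j G), avg U ∈ E → ρ (Φf U) = ρ U) :
    (fun U => ρ (Φf U) * E.indicator (fun _ => (1 : ℝ)) (avg (Φf U))) =ᵐ[fieldMeasure P j G]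
      fun U => ρ U * E.indicator (fun _ => (1 : ℝ)) (avg U) := by
  filter_upwards [hinv] with U hU
  rw [hinter]
  by_cases hE : avg U ∈ E
  · rw [indicator_of_mem hE, indicator_of_mem ((hEst _).2 hE), hU hE]
  · rw [indicator_of_notMem hE, indicator_of_notMem (fun h => hE ((hEst _).1 h)), mul_zero, mul_zero]

end Cut

/-! ## §3. The transform of record on a stable set: a.e. invariance under an equivariant pair -/

section Record

variable {F : T4Family} {N : ℕ} [NeZero N]

/-- **THE TRANSFORM OF RECORD IS A.E. INVARIANT ON A STABLE SET OVER WHICH `ρ` IS A.E.-INVARIANT** — generic equivariant pair `(Φf, Φc)` of integral-preserving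
bijections of the level-`k` ∕ level-`k+1` configurations with `Ū ∘ Φf = Φc ∘ Ū` (`k < K`, `ρ` integrable, `E` measurable and `Φc`-stable): `dV`-a.e. `V ∈ E` has
`(Tρ)(Φc V) = (Tρ)(V)`.  (Gauge twin: dag-n09-w3 `transportOfRecord_gaugeAct_ae_eq_on`.) [cite: Balaban1987RG1, (0.13) p.254, (2.1) p.265, (2.17) p.269] -/
theorem transportOfRecord_comp_ae_eq_on {K k : ℕ} (hk : k < K) {ρ : Density (F.P K) k (SU N)} (hρ : Integrable ρ (fieldMeasure (F.P K) k (SU N)))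
    (Φf Ψf : GaugeField (F.P K) k (SU N) → GaugeField (F.P K) k (SU N))
    (Φc Ψc : GaugeField (F.P K) (k + 1) (SU N) → GaugeField (F.P K) (k + 1) (SU N))
    (hIf : ∀ g : GaugeField (F.P K) k (SU N) → ℝ, ∫ U, g (Φf U) ∂(fieldMeasure (F.P K) k (SU N)) = ∫ U, g U ∂(fieldMeasure (F.P K) k (SU N)))
    (hIc : ∀ g : GaugeField (F.P K) (k + 1) (SU N) → ℝ,
      ∫ V, g (Φc V) ∂(fieldMeasure (F.P K) (k + 1) (SU N)) = ∫ V, g V ∂(fieldMeasure (F.P K) (k + 1) (SU N)))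
    (hΦc : MeasurePreserving Φc (fieldMeasure (F.P K) (k + 1) (SU N)) (fieldMeasure (F.P K) (k + 1) (SU N)))
    (hΨc : Measurable Ψc) (hΨΦc : ∀ V, Ψc (Φc V) = V) (hΨΦf : ∀ U, Ψf (Φf U) = U) (hΦΨf : ∀ U, Φf (Ψf U) = U)
    (hinter : ∀ U, (avOfRecord F N K k).avg (Φf U) = Φc ((avOfRecord F N K k).avg U))
    {E : Set (GaugeField (F.P K) (k + 1) (SU N))} (hE : MeasurableSet E) (hEst : ∀ V, Φc V ∈ E ↔ V ∈ E)
    (hinv : ∀ᵐ U ∂(fieldMeasure (F.P K) k (SU N)), (avOfRecord F N K k).avg U ∈ E → ρ (Φf U) = ρ U) :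
    ∀ᵐ V ∂(fieldMeasure (F.P K) (k + 1) (SU N)), V ∈ E → transportOfRecord F N K k ρ (Φc V) = transportOfRecord F N K k ρ V := by
  set ρE : Density (F.P K) k (SU N) := fun U => ρ U * E.indicator (fun _ => (1 : ℝ)) ((avOfRecord F N K k).avg U) with hρEdef
  have hφ : Measurable (E.indicator fun _ : GaugeField (F.P K) (k + 1) (SU N) => (1 : ℝ)) := measurable_const.indicator hE
  have hφb : ∀ V, |E.indicator (fun _ : GaugeField (F.P K) (k + 1) (SU N) => (1 : ℝ)) V| ≤ 1 := fun V => by by_cases hV : V ∈ E <;> simp [hV]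
  have hρE : Integrable ρE (fieldMeasure (F.P K) k (SU N)) :=
    hρ.mul_bdd ((hφ.comp (avOfRecord_measurable F N K k)).aestronglyMeasurable) (Eventually.of_forall fun U => by rw [Real.norm_eq_abs]; exact hφb _)
  have hRT := isRT_transportOfRecord F N K k hk ρE hρE
  have hiT : Integrable (transportOfRecord F N K k ρE) (fieldMeasure (F.P K) (k + 1) (SU N)) :=
    integrable_kernelTransport (fieldMeasure (F.P K) k (SU N)) (fieldMeasure (F.P K) (k + 1) (SU N)) (avOfRecord_measurable F N K k)
      (avOfRecord_haarAC F N K k hk) hρE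
  have hcut : (fun U => ρE (Φf U)) =ᵐ[fieldMeasure (F.P K) k (SU N)] ρE := ae_comp_cutDensity_of_on Φf Φc hEst hinter hinv
  have hTinv : (fun V => transportOfRecord F N K k ρE (Φc V)) =ᵐ[fieldMeasure (F.P K) (k + 1) (SU N)] transportOfRecord F N K k ρE :=
    ae_eq_of_isRT (isRT_comp_equivariant_of_eventuallyEq hRT Φf Ψf Φc Ψc hIf hIc hΨc hΨΦc hΨΦf hΦΨf hinter hcut) hRT
      (hΦc.integrable_comp_of_integrable hiT) hiT
  have hloc := transportOfRecord_mul_indicator_ae_eq hk hρ hE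
  have hloc' : (fun V => transportOfRecord F N K k ρE (Φc V)) =ᵐ[fieldMeasure (F.P K) (k + 1) (SU N)]
      fun V => transportOfRecord F N K k ρ (Φc V) * E.indicator (fun _ => (1 : ℝ)) (Φc V) :=
    hΦc.quasiMeasurePreserving.ae_eq_comp hloc
  filter_upwards [hTinv, hloc, hloc'] with V h1 h2 h3 hV
  have hV' : Φc V ∈ E := (hEst V).2 hV
  have e := (h3.symm.trans h1).trans h2
  simp only [indicator_of_mem hV, indicator_of_mem hV', mul_one] at e
  exact e

/-- **… under the coarse translations `τ_a`** (fine map `τ_{La}`). [cite: Balaban1987RG1, (2.17) p.269, (0.13) p.254] -/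
theorem transportOfRecord_translate_ae_eq_on {K k : ℕ} (hk : k < K) {ρ : Density (F.P K) k (SU N)} (hρ : Integrable ρ (fieldMeasure (F.P K) k (SU N)))
    (a : Site (F.P K) (k + 1)) {E : Set (GaugeField (F.P K) (k + 1) (SU N))} (hE : MeasurableSet E)
    (hEst : ∀ V : GaugeField (F.P K) (k + 1) (SU N), V.translate a ∈ E ↔ V ∈ E)
    (hinv : ∀ᵐ U ∂(fieldMeasure (F.P K) k (SU N)), (avOfRecord F N K k).avg U ∈ E → ρ (U.translate (Site.scale a)) = ρ U) :
    ∀ᵐ V ∂(fieldMeasure (F.P K) (k + 1) (SU N)), V ∈ E → transportOfRecord F N K k ρ (V.translate a) = transportOfRecord F N K k ρ V :=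
  transportOfRecord_comp_ae_eq_on hk hρ (GaugeField.translate (Site.scale a)) (GaugeField.translate (Site.scale (-a)))
    (GaugeField.translate a) (GaugeField.translate (-a)) (GaugeField.integral_comp_translate _) (GaugeField.integral_comp_translate _)
    (GaugeField.measurePreserving_translate a) (GaugeField.measurePreserving_translate (-a)).measurable
    (fun V => by rw [GaugeField.translate_translate, neg_add_cancel, GaugeField.translate_zero])
    (fun U => by rw [GaugeField.translate_translate, map_neg, neg_add_cancel, GaugeField.translate_zero])
    (fun U => by rw [GaugeField.translate_translate, map_neg, add_neg_cancel, GaugeField.translate_zero])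
    (fun U => by rw [avOfRecord_apply]; exact BlockAveraging.blockAvg_translate _ a U) hE hEst hinv

/-- **… under the coordinate permutations `π`.** [cite: Balaban1987RG1, (2.17) p.269, (0.13) p.254] -/
theorem transportOfRecord_permute_ae_eq_on {K k : ℕ} (hk : k < K) {ρ : Density (F.P K) k (SU N)} (hρ : Integrable ρ (fieldMeasure (F.P K) k (SU N)))
    (π : Equiv.Perm (Fin (F.P K).d)) {E : Set (GaugeField (F.P K) (k + 1) (SU N))} (hE : MeasurableSet E)
    (hEst : ∀ V : GaugeField (F.P K) (k + 1) (SU N), V.permute π ∈ E ↔ V ∈ E)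
    (hinv : ∀ᵐ U ∂(fieldMeasure (F.P K) k (SU N)), (avOfRecord F N K k).avg U ∈ E → ρ (U.permute π) = ρ U) :
    ∀ᵐ V ∂(fieldMeasure (F.P K) (k + 1) (SU N)), V ∈ E → transportOfRecord F N K k ρ (V.permute π) = transportOfRecord F N K k ρ V :=
  transportOfRecord_comp_ae_eq_on hk hρ (GaugeField.permute π) (GaugeField.permute π⁻¹) (GaugeField.permute π) (GaugeField.permute π⁻¹)
    (GaugeField.integral_comp_permute _) (GaugeField.integral_comp_permute _)
    (GaugeField.measurePreserving_permute π) (GaugeField.measurePreserving_permute π⁻¹).measurable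
    (fun V => by rw [GaugeField.permute_permute, mul_inv_cancel, GaugeField.permute_one])
    (fun U => by rw [GaugeField.permute_permute, mul_inv_cancel, GaugeField.permute_one])
    (fun U => by rw [GaugeField.permute_permute, inv_mul_cancel, GaugeField.permute_one])
    (fun U => by rw [avOfRecord_apply]; exact BlockAveraging.blockAvg_permute _ π U) hE hEst hinv

/-- **… under the centre reflections `c_ρ`.** [cite: Balaban1987RG1, (2.17)–(2.18) p.269, (0.13) p.254] -/
theorem transportOfRecord_creflect_ae_eq_on {K k : ℕ} (hk : k < K) {ρ : Density (F.P K) k (SU N)} (hρ : Integrable ρ (fieldMeasure (F.P K) k (SU N)))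
    (r : Fin (F.P K).d) {E : Set (GaugeField (F.P K) (k + 1) (SU N))} (hE : MeasurableSet E)
    (hEst : ∀ V : GaugeField (F.P K) (k + 1) (SU N), V.creflect r ∈ E ↔ V ∈ E)
    (hinv : ∀ᵐ U ∂(fieldMeasure (F.P K) k (SU N)), (avOfRecord F N K k).avg U ∈ E → ρ (U.creflect r) = ρ U) :
    ∀ᵐ V ∂(fieldMeasure (F.P K) (k + 1) (SU N)), V ∈ E → transportOfRecord F N K k ρ (V.creflect r) = transportOfRecord F N K k ρ V :=
  transportOfRecord_comp_ae_eq_on hk hρ (GaugeField.creflect r) (GaugeField.creflect r) (GaugeField.creflect r) (GaugeField.creflect r)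
    (integral_comp_creflect _) (integral_comp_creflect _) (measurePreserving_creflect r) (measurePreserving_creflect r).measurable
    (fun V => B12EuclClause263.creflect_creflect r V) (fun U => B12EuclClause263.creflect_creflect r U) (fun U => B12EuclClause263.creflect_creflect r U)
    (fun U => by rw [avOfRecord_apply]; exact BlockAveraging.blockAvg_creflect _ r U) hE hEst hinv

/-! ## §4. The canonical-version transport on `regSetOfRecord ∩ O` -/

/-- **`TcanOfRecord K k ρ (Φc V) = TcanOfRecord K k ρ V` AT EVERY `V ∈ regSetOfRecord K k ρ ∩ O`** for an OPEN `Φc`-stable set `O` over which `ρ` is a.e.-invariant under the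
fine map — generic equivariant pair of continuous measure-preserving bijections (localised determinacy `canonVersion_comp_eqOn_inter_of_on`).  (Gauge twin: dag-n09-w3
`TcanOfRecord_gaugeAct_of_mem_regSet_inter_of_on`.) [cite: Balaban1987RG1, (0.13) p.254, p.263, (2.17) p.269] -/
theorem TcanOfRecord_comp_of_mem_regSet_inter_of_on {K k : ℕ} (hk : k < K) {ρ : Density (F.P K) k (SU N)} (hρ : Integrable ρ (fieldMeasure (F.P K) k (SU N)))
    (Φf Ψf : GaugeField (F.P K) k (SU N) → GaugeField (F.P K) k (SU N))
    (Φc Ψc : GaugeField (F.P K) (k + 1) (SU N) → GaugeField (F.P K) (k + 1) (SU N))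
    (hIf : ∀ g : GaugeField (F.P K) k (SU N) → ℝ, ∫ U, g (Φf U) ∂(fieldMeasure (F.P K) k (SU N)) = ∫ U, g U ∂(fieldMeasure (F.P K) k (SU N)))
    (hIc : ∀ g : GaugeField (F.P K) (k + 1) (SU N) → ℝ,
      ∫ V, g (Φc V) ∂(fieldMeasure (F.P K) (k + 1) (SU N)) = ∫ V, g V ∂(fieldMeasure (F.P K) (k + 1) (SU N)))
    (hΦc : MeasurePreserving Φc (fieldMeasure (F.P K) (k + 1) (SU N)) (fieldMeasure (F.P K) (k + 1) (SU N)))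
    (hΨcmp : MeasurePreserving Ψc (fieldMeasure (F.P K) (k + 1) (SU N)) (fieldMeasure (F.P K) (k + 1) (SU N)))
    (hΦcc : Continuous (X := PBond (F.P K) (k + 1) → SU N) (Y := PBond (F.P K) (k + 1) → SU N) Φc)
    (hΨcc : Continuous (X := PBond (F.P K) (k + 1) → SU N) (Y := PBond (F.P K) (k + 1) → SU N) Ψc)
    (hΨΦc : ∀ V, Ψc (Φc V) = V) (hΦΨc : ∀ V, Φc (Ψc V) = V) (hΨΦf : ∀ U, Ψf (Φf U) = U) (hΦΨf : ∀ U, Φf (Ψf U) = U)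
    (hinter : ∀ U, (avOfRecord F N K k).avg (Φf U) = Φc ((avOfRecord F N K k).avg U))
    {O : Set (GaugeField (F.P K) (k + 1) (SU N))} (hOo : IsOpen (X := PBond (F.P K) (k + 1) → SU N) O) (hOst : ∀ V, Φc V ∈ O ↔ V ∈ O)
    (hinv : ∀ᵐ U ∂(fieldMeasure (F.P K) k (SU N)), (avOfRecord F N K k).avg U ∈ O → ρ (Φf U) = ρ U)
    {V : PBond (F.P K) (k + 1) → SU N} (hV : V ∈ regSetOfRecord F N K k ρ ∩ O) :
    TcanOfRecord F N K k ρ (Φc V) = TcanOfRecord F N K k ρ V := by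
  haveI := isOpenPosMeasure_piHaar_SUN N (F.P K) (k + 1)
  have hOm : MeasurableSet O := hOo.measurableSet
  have hae := transportOfRecord_comp_ae_eq_on hk hρ Φf Ψf Φc Ψc hIf hIc hΦc hΨcmp.measurable hΨΦc hΨΦf hΦΨf hinter hOm hOst hinv
  have hinv' : (fun V : PBond (F.P K) (k + 1) → SU N => transportOfRecord F N K k ρ V) ∘ Φc
      =ᵐ[(piHaar (F.P K) (k + 1) (SU N)).restrict O] fun V => transportOfRecord F N K k ρ V :=
    (ae_restrict_iff' (μ := piHaar (F.P K) (k + 1) (SU N)) hOm).2 hae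
  exact canonVersion_comp_eqOn_inter_of_on (μ := piHaar (F.P K) (k + 1) (SU N)) (f := fun V => transportOfRecord F N K k ρ V)
    hΦcc hΨcc hΦc hΨcmp hΨΦc hΦΨc hOo (fun W hW => (hOst W).2 hW) hinv' hV

/-- **`TcanOfRecord` is translation invariant on `regSetOfRecord ∩ O`.** [cite: Balaban1987RG1, (2.17) p.269, p.263] -/
theorem TcanOfRecord_translate_of_mem_regSet_inter_of_on {K k : ℕ} (hk : k < K) {ρ : Density (F.P K) k (SU N)}
    (hρ : Integrable ρ (fieldMeasure (F.P K) k (SU N))) (a : Site (F.P K) (k + 1)) {O : Set (GaugeField (F.P K) (k + 1) (SU N))}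
    (hOo : IsOpen (X := PBond (F.P K) (k + 1) → SU N) O) (hOst : ∀ V : GaugeField (F.P K) (k + 1) (SU N), V.translate a ∈ O ↔ V ∈ O)
    (hinv : ∀ᵐ U ∂(fieldMeasure (F.P K) k (SU N)), (avOfRecord F N K k).avg U ∈ O → ρ (U.translate (Site.scale a)) = ρ U)
    {V : PBond (F.P K) (k + 1) → SU N} (hV : V ∈ regSetOfRecord F N K k ρ ∩ O) :
    TcanOfRecord F N K k ρ (GaugeField.translate a V) = TcanOfRecord F N K k ρ V :=
  TcanOfRecord_comp_of_mem_regSet_inter_of_on hk hρ (GaugeField.translate (Site.scale a)) (GaugeField.translate (Site.scale (-a)))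
    (GaugeField.translate a) (GaugeField.translate (-a)) (GaugeField.integral_comp_translate _) (GaugeField.integral_comp_translate _)
    (GaugeField.measurePreserving_translate a) (GaugeField.measurePreserving_translate (-a)) (continuous_translate a) (continuous_translate (-a))
    (fun V => by rw [GaugeField.translate_translate, neg_add_cancel, GaugeField.translate_zero])
    (fun V => by rw [GaugeField.translate_translate, add_neg_cancel, GaugeField.translate_zero])
    (fun U => by rw [GaugeField.translate_translate, map_neg, neg_add_cancel, GaugeField.translate_zero])
    (fun U => by rw [GaugeField.translate_translate, map_neg, add_neg_cancel, GaugeField.translate_zero])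
    (fun U => by rw [avOfRecord_apply]; exact BlockAveraging.blockAvg_translate _ a U) hOo hOst hinv hV

/-- **`TcanOfRecord` is permutation invariant on `regSetOfRecord ∩ O`.** [cite: Balaban1987RG1, (2.17) p.269, p.263] -/
theorem TcanOfRecord_permute_of_mem_regSet_inter_of_on {K k : ℕ} (hk : k < K) {ρ : Density (F.P K) k (SU N)}
    (hρ : Integrable ρ (fieldMeasure (F.P K) k (SU N))) (π : Equiv.Perm (Fin (F.P K).d)) {O : Set (GaugeField (F.P K) (k + 1) (SU N))}
    (hOo : IsOpen (X := PBond (F.P K) (k + 1) → SU N) O) (hOst : ∀ V : GaugeField (F.P K) (k + 1) (SU N), V.permute π ∈ O ↔ V ∈ O)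
    (hinv : ∀ᵐ U ∂(fieldMeasure (F.P K) k (SU N)), (avOfRecord F N K k).avg U ∈ O → ρ (U.permute π) = ρ U)
    {V : PBond (F.P K) (k + 1) → SU N} (hV : V ∈ regSetOfRecord F N K k ρ ∩ O) :
    TcanOfRecord F N K k ρ (GaugeField.permute π V) = TcanOfRecord F N K k ρ V :=
  TcanOfRecord_comp_of_mem_regSet_inter_of_on hk hρ (GaugeField.permute π) (GaugeField.permute π⁻¹) (GaugeField.permute π) (GaugeField.permute π⁻¹)
    (GaugeField.integral_comp_permute _) (GaugeField.integral_comp_permute _)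
    (GaugeField.measurePreserving_permute π) (GaugeField.measurePreserving_permute π⁻¹) (continuous_permute π) (continuous_permute π⁻¹)
    (fun V => by rw [GaugeField.permute_permute, mul_inv_cancel, GaugeField.permute_one])
    (fun V => by rw [GaugeField.permute_permute, inv_mul_cancel, GaugeField.permute_one])
    (fun U => by rw [GaugeField.permute_permute, mul_inv_cancel, GaugeField.permute_one])
    (fun U => by rw [GaugeField.permute_permute, inv_mul_cancel, GaugeField.permute_one])
    (fun U => by rw [avOfRecord_apply]; exact BlockAveraging.blockAvg_permute _ π U) hOo hOst hinv hV

/-- **`TcanOfRecord` is invariant under the centre reflections on `regSetOfRecord ∩ O`.** [cite: Balaban1987RG1, (2.17)–(2.18) p.269, p.263] -/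
theorem TcanOfRecord_creflect_of_mem_regSet_inter_of_on {K k : ℕ} (hk : k < K) {ρ : Density (F.P K) k (SU N)}
    (hρ : Integrable ρ (fieldMeasure (F.P K) k (SU N))) (r : Fin (F.P K).d) {O : Set (GaugeField (F.P K) (k + 1) (SU N))}
    (hOo : IsOpen (X := PBond (F.P K) (k + 1) → SU N) O) (hOst : ∀ V : GaugeField (F.P K) (k + 1) (SU N), V.creflect r ∈ O ↔ V ∈ O)
    (hinv : ∀ᵐ U ∂(fieldMeasure (F.P K) k (SU N)), (avOfRecord F N K k).avg U ∈ O → ρ (U.creflect r) = ρ U)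
    {V : PBond (F.P K) (k + 1) → SU N} (hV : V ∈ regSetOfRecord F N K k ρ ∩ O) :
    TcanOfRecord F N K k ρ (GaugeField.creflect r V) = TcanOfRecord F N K k ρ V :=
  TcanOfRecord_comp_of_mem_regSet_inter_of_on hk hρ (GaugeField.creflect r) (GaugeField.creflect r) (GaugeField.creflect r) (GaugeField.creflect r)
    (integral_comp_creflect _) (integral_comp_creflect _) (measurePreserving_creflect r) (measurePreserving_creflect r)
    (continuous_creflect r) (continuous_creflect r)
    (fun V => B12EuclClause263.creflect_creflect r V) (fun V => B12EuclClause263.creflect_creflect r V)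
    (fun U => B12EuclClause263.creflect_creflect r U) (fun U => B12EuclClause263.creflect_creflect r U)
    (fun U => by rw [avOfRecord_apply]; exact BlockAveraging.blockAvg_creflect _ r U) hOo hOst hinv hV

end Record

end Literature.MathematicalPhysics.QuantumFieldTheory.Balaban1983to89.Node00

end
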